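import Summits.HodgeConjecture.HodgeConjecture.Theorems.K2E5QuatLocalMeasureDefs   -- ★ #3f (p855259): `quatLocalUnits`, `quatLocalUnitsLevel`, `quatLocalLevelTwoP`, `isClosed_quatLocalUnits`
import Literature.NumberTheory.Automorphic.LocalGLCongruenceBoxIwahori              -- ★ `isCompact_setOf_forall_mem_congruenceGL`, `localGLPiEquiv_apply_apply` (+ ★ `congruenceGL`, `ValBound`)
import HarnessLib

/-!
# K2 ∕ E5 «TamagawaUnitary», unit QUAT-LOCAL — FILE H1 `K2E5QuatLocalLevelFinite`: `[Λ_v^× : Λ_v^×(2p)] ≠ 0`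
# (socket `QuatLocal.sig_K2E5QuatLocalLevelFinite` BY NAME)

Cell `hodgecm-mathlib` (Track B «K2-LIT»), item h413 = `stmt-HodgeConjecture-24833`; tier-0 line `Cruxes/H413/Lines/K2_E5_TamagawaUnitary.lean` (ED. 3),
tier-1 socket module `Cruxes/H413/Lines/K2_E5_TamagawaUnitary_QuatLocal.lean` (K2E5-plan (g0), 2026-09-03T22:29Z), socket
`…Cruxes.H413.K2E5TamagawaUnitary.QuatLocal.sig_K2E5QuatLocalLevelFinite` (H1, size S–M; dealt BY NAME to K2E5-p12 22:25:40Z).  PROOF lane (theorems only); author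
K2E5-p12 (g0).  Per the cell protocol the Lines module is NOT imported: the TYPE of `quatLocalLevelFinite` below is the socket's statement token for token (same `open`s),
certified at home by `example : type_of% @quatLocalLevelFinite = type_of% @….sig_K2E5QuatLocalLevelFinite := rfl` (`K2/K2E5-p12/g0/Probe_K2E5QuatLocalLevelFinite.lean`).

Content.  For the local order `Λ_v = D_v ∩ M₂(𝒪_{E_v})` of the matrix model of the quaternion algebra `D_h` at a finite place `v` (★ #3f `K2E5QuatLocalMeasureDefs`):
the congruence level `Λ_v^×(2p) = {g : g − 1, g⁻¹ − 1 ∈ 2p·M₂(𝒪_{E_v})}` (★ `quatLocalLevelTwoP`) has FINITE INDEX in the unit group `Λ_v^× = {g : g, g⁻¹ ∈ M₂(𝒪_{E_v})}`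
(★ `quatLocalUnitsLevel`).  Proof = the D-twin of ★ `Weil1982.UnitaryFinTopForm.relIndex_levelTwoP_ne_zero`:
(§1) the set `{g ∈ GL₂(E_v) | g, g⁻¹ ∈ M₂(𝒪_{E_v})}` IS the congruence box `{g | ∀ w, g_w ∈ K_{E_w}(1) = GL₂(𝒪_w)}` of ★ `LocalGLCongruenceBoxIwahori` (entries of the
`w`-component are the `w`-components of the entries, ★ `localGLPiEquiv_apply_apply`; integrality `↔ valuation ≤ 1`), hence COMPACT (★ `isCompact_setOf_forall_mem_congruenceGL`);
`Λ_v^×` is its intersection with the closed `(D_v)^×` (★ `isClosed_quatLocalUnits`), hence compact; (§2) `Λ_v^×(2p)` is cut out of `Λ_v^×` by the OPEN conditions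
`g − 1, g⁻¹ − 1 ∈ 2p·M₂(𝒪)` (★ `isOpen_twoPIntMatrices`); (§3) an open subgroup of a compact group has finite index (Mathlib `Subgroup.quotient_finite_of_isOpen`).
[PlatonovRapinchuk1994, §3.3: congruence subgroups are open of finite index in the compact group of integral points]; [VignerasLNM800, Ch. II §4 Lemme 4.6].

HONEST LABEL: HC_CM is proved only modulo the 7 printed citations (2 remaining named inputs: hLiu418 = stmt-HodgeConjecture-24832,
h413 = stmt-HodgeConjecture-24833) until rung 0 closes; this file closes ONE size-S–M socket of ONE tier-1 unit as a HELPER and discharges none of them.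
References: [PlatonovRapinchuk1994] V. Platonov, A. Rapinchuk, *Algebraic groups and number theory* (1994), §3.3 · [VignerasLNM800] M.-F. Vignéras, *Arithmétique des algèbres de
quaternions*, LNM 800 (1980), Ch. II §4 Lemme 4.6 · [Weil1982] A. Weil, *Adeles and algebraic groups*, PM 23 (1982), Ch. II §2.2.
-/

set_option autoImplicit false
set_option linter.dupNamespace false

noncomputable section

namespace Summit.HodgeConjecture.HodgeConjecture.Cruxes.H413.K2E5QuatLocalLevelFinite

open NumberField IsDedekindDomain
open scoped NNReal
open Literature.NumberTheory.Automorphic Literature.NumberTheory.Automorphic.UnitaryGroup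
open Literature.NumberTheory.Weil1982.UnitaryFinTopForm
open Literature.NumberTheory.K2Lit.UnitarySUTamagawaDensity
open Summit.HodgeConjecture.HodgeConjecture.Cruxes.H413.K2E5QuatLocalMeasure
open scoped MatrixGroups Matrix

variable (L : Type) [Field L] [NumberField L] [IsCMField L] (Ha : Matrix (Fin 2) (Fin 2) L) (v : HeightOneSpectrum (𝓞 ↥(maximalRealSubfield L)))

/-! ## §1 `{g | g, g⁻¹ ∈ M₂(𝒪_{E_v})}` is the level-`1` congruence box, hence compact; `Λ_v^×` is compact -/

omit [IsCMField L] in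
/-- An integral matrix over `E_v` has `w`-components of valuation `≤ 1` in every entry (★ `mem_intMatrices_iff`, ★ `mem_localIntegers_iff`, `Valuation.mem_integer_iff`).
[cite: PlatonovRapinchuk1994, §3.3] -/
theorem valBound_one_of_mem_intMatrices {g : GL (Fin 2) (LocalRing L v)} (hg : (g : GL (Fin 2) (LocalRing L v)).val ∈ intMatrices L 2 v) (w : PlacesOver L v) :
    ValBound 1 ((localGLPiEquiv L 2 v g w : GL (Fin 2) (w.1.adicCompletion L)) : Matrix (Fin 2) (Fin 2) (w.1.adicCompletion L)) := by
  intro i j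
  rw [localGLPiEquiv_apply_apply]
  exact (Valuation.mem_integer_iff _ _).1 ((mem_localIntegers_iff L v _).1 ((Literature.NumberTheory.Weil1982.UnitaryFinTopForm.mem_intMatrices_iff L 2 v _).1 hg i j) w)

omit [IsCMField L] in
/-- Conversely: if every `w`-component of `g` is integral then `g` is an integral matrix over `E_v`. [cite: PlatonovRapinchuk1994, §3.3] -/
theorem mem_intMatrices_of_valBound_one {g : GL (Fin 2) (LocalRing L v)}
    (hg : ∀ w : PlacesOver L v, ValBound 1 ((localGLPiEquiv L 2 v g w : GL (Fin 2) (w.1.adicCompletion L)) : Matrix (Fin 2) (Fin 2) (w.1.adicCompletion L))) :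
    (g : GL (Fin 2) (LocalRing L v)).val ∈ intMatrices L 2 v := by
  rw [Literature.NumberTheory.Weil1982.UnitaryFinTopForm.mem_intMatrices_iff]
  intro i j
  rw [mem_localIntegers_iff]
  intro w
  have h := hg w i j
  rw [localGLPiEquiv_apply_apply] at h
  exact (Valuation.mem_integer_iff _ _).2 h

omit [IsCMField L] in
/-- **`{g ∈ GL₂(E_v) | g, g⁻¹ ∈ M₂(𝒪_{E_v})}` IS the level-`1` congruence box** `{g | ∀ w, g_w ∈ K_{E_w}(1)}` of ★ `LocalGLCongruenceBoxIwahori`.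
[cite: PlatonovRapinchuk1994, §3.3] -/
theorem setOf_integral_eq_box :
    {g : GL (Fin 2) (LocalRing L v) | (g : GL (Fin 2) (LocalRing L v)).val ∈ intMatrices L 2 v ∧ (g⁻¹ : GL (Fin 2) (LocalRing L v)).val ∈ intMatrices L 2 v} =
      {g : GL (Fin 2) (LocalRing L v) | ∀ w, localGLPiEquiv L 2 v g w ∈ congruenceGL 2 (1 : ValuativeRel.ValueGroupWithZero (w.1.adicCompletion L))} := by
  ext g
  simp only [Set.mem_setOf_eq]
  constructor
  · rintro ⟨h1, h2⟩ w
    have hi : ValBound 1 ((localGLPiEquiv L 2 v g w : GL (Fin 2) (w.1.adicCompletion L)) : Matrix (Fin 2) (Fin 2) (w.1.adicCompletion L)) :=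
      valBound_one_of_mem_intMatrices L v h1 w
    have hi' : ValBound 1 (((localGLPiEquiv L 2 v g w)⁻¹ : GL (Fin 2) (w.1.adicCompletion L)) : Matrix (Fin 2) (Fin 2) (w.1.adicCompletion L)) := by
      rw [← Pi.inv_apply, ← map_inv]
      exact valBound_one_of_mem_intMatrices L v h2 w
    exact mem_congruenceGL_iff.2 ⟨⟨hi, hi'⟩, hi.sub valBound_one, hi'.sub valBound_one⟩
  · intro h
    refine ⟨mem_intMatrices_of_valBound_one L v fun w => (mem_congruenceGL_iff.1 (h w)).1.1, mem_intMatrices_of_valBound_one L v fun w => ?_⟩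
    rw [map_inv, Pi.inv_apply]
    exact (mem_congruenceGL_iff.1 (h w)).1.2

omit [IsCMField L] in
/-- Hence `{g | g, g⁻¹ ∈ M₂(𝒪_{E_v})}` is COMPACT (★ `isCompact_setOf_forall_mem_congruenceGL`). [cite: PlatonovRapinchuk1994, §3.3] -/
theorem isCompact_setOf_integral :
    IsCompact {g : GL (Fin 2) (LocalRing L v) | (g : GL (Fin 2) (LocalRing L v)).val ∈ intMatrices L 2 v ∧ (g⁻¹ : GL (Fin 2) (LocalRing L v)).val ∈ intMatrices L 2 v} := by
  rw [setOf_integral_eq_box]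
  exact isCompact_setOf_forall_mem_congruenceGL L 2 v fun w => (1 : ValuativeRel.ValueGroupWithZero (w.1.adicCompletion L))

/-- **`Λ_v^×` is compact**: `Λ_v^× = (D_v)^× ∩ {g | g, g⁻¹ ∈ M₂(𝒪_{E_v})}`, closed ∩ compact (★ #3f `isClosed_quatLocalUnits`). [cite: PlatonovRapinchuk1994, §3.3] [cite: VignerasLNM800, Ch. II §4] -/
theorem isCompact_quatLocalUnitsLevel : IsCompact ((quatLocalUnitsLevel L Ha v : Subgroup (GL (Fin 2) (LocalRing L v))) : Set (GL (Fin 2) (LocalRing L v))) := by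
  have h : ((quatLocalUnitsLevel L Ha v : Subgroup (GL (Fin 2) (LocalRing L v))) : Set (GL (Fin 2) (LocalRing L v))) =
      {g : GL (Fin 2) (LocalRing L v) | (g : GL (Fin 2) (LocalRing L v)).val ∈ intMatrices L 2 v ∧ (g⁻¹ : GL (Fin 2) (LocalRing L v)).val ∈ intMatrices L 2 v} ∩
        (quatLocalUnits L Ha v : Set (GL (Fin 2) (LocalRing L v))) := by
    ext g
    simp only [SetLike.mem_coe, mem_quatLocalUnitsLevel_iff, Set.mem_inter_iff, Set.mem_setOf_eq]
    tauto
  rw [h]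
  exact (isCompact_setOf_integral L v).inter_right (isClosed_quatLocalUnits L Ha v)

/-! ## §2 `Λ_v^×(2p)` is open in `Λ_v^×` -/

omit [IsCMField L] in
/-- The conditions `g − 1 ∈ 2p·M₂(𝒪)`, `g⁻¹ − 1 ∈ 2p·M₂(𝒪)` cut out an OPEN subset of `GL₂(E_v)` (★ `isOpen_twoPIntMatrices`). [cite: PlatonovRapinchuk1994, §3.3] -/
theorem isOpen_setOf_levelTwoP :
    IsOpen {g : GL (Fin 2) (LocalRing L v) | (g : GL (Fin 2) (LocalRing L v)).val - 1 ∈ twoPIntMatrices L 2 v ∧ (g⁻¹ : GL (Fin 2) (LocalRing L v)).val - 1 ∈ twoPIntMatrices L 2 v} :=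
  ((isOpen_twoPIntMatrices L 2 v).preimage (Units.continuous_val.sub continuous_const)).inter
    ((isOpen_twoPIntMatrices L 2 v).preimage (Units.continuous_coe_inv.sub continuous_const))

/-- `Λ_v^×(2p)`, read inside `Λ_v^×`, is open there. [cite: PlatonovRapinchuk1994, §3.3] -/
theorem isOpen_levelTwoP_subgroupOf :
    IsOpen ((((quatLocalLevelTwoP L Ha v).subgroupOf (quatLocalUnitsLevel L Ha v) : Subgroup ↥(quatLocalUnitsLevel L Ha v))) : Set ↥(quatLocalUnitsLevel L Ha v)) := by
  have e : ((((quatLocalLevelTwoP L Ha v).subgroupOf (quatLocalUnitsLevel L Ha v) : Subgroup ↥(quatLocalUnitsLevel L Ha v))) : Set ↥(quatLocalUnitsLevel L Ha v)) =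
      Subtype.val ⁻¹' {g : GL (Fin 2) (LocalRing L v) | (g : GL (Fin 2) (LocalRing L v)).val - 1 ∈ twoPIntMatrices L 2 v ∧
        (g⁻¹ : GL (Fin 2) (LocalRing L v)).val - 1 ∈ twoPIntMatrices L 2 v} := by
    ext g
    rw [Subgroup.coe_subgroupOf, Set.mem_preimage, Set.mem_preimage, SetLike.mem_coe, mem_quatLocalLevelTwoP_iff, Set.mem_setOf_eq]
    exact ⟨fun h => h.2, fun h => ⟨((mem_quatLocalUnitsLevel_iff L Ha v _).1 g.2).1, h⟩⟩
  rw [e]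
  exact (isOpen_setOf_levelTwoP L v).preimage continuous_subtype_val

/-! ## §3 The socket -/

/-- **FILE H1 `K2E5QuatLocalLevelFinite` — socket `QuatLocal.sig_K2E5QuatLocalLevelFinite` proved, statement token for token.**  `[Λ_v^× : Λ_v^×(2p)] ≠ 0`: an open subgroup
(§2) of the compact group `Λ_v^×` (§1) has finite index (Mathlib `Subgroup.quotient_finite_of_isOpen`, `Subgroup.index_ne_zero_of_finite`).  The hermitian ∕ non-degeneracy
hypotheses are carried, not used.  [cite: PlatonovRapinchuk1994, §3.3 (congruence subgroups are open of finite index in the compact group of integral points)]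
[cite: VignerasLNM800, Ch. II §4 Lemme 4.6] -/
theorem quatLocalLevelFinite :
    ∀ (L : Type) [Field L] [NumberField L] [IsCMField L] (Ha : Matrix (Fin 2) (Fin 2) L)
      (_ : (Ha.map (cmConjRingHom L)).transpose = Ha) (_ : Ha.det ≠ 0) (v : HeightOneSpectrum (𝓞 ↥(maximalRealSubfield L))),
      (quatLocalLevelTwoP L Ha v).relIndex (quatLocalUnitsLevel L Ha v) ≠ 0 := by
  intro L _ _ _ Ha _ _ v
  haveI : CompactSpace ↥(quatLocalUnitsLevel L Ha v) := isCompact_iff_compactSpace.1 (isCompact_quatLocalUnitsLevel L Ha v)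
  haveI : Finite (↥(quatLocalUnitsLevel L Ha v) ⧸ (quatLocalLevelTwoP L Ha v).subgroupOf (quatLocalUnitsLevel L Ha v)) :=
    Subgroup.quotient_finite_of_isOpen _ (isOpen_levelTwoP_subgroupOf L Ha v)
  rw [Subgroup.relIndex]
  exact Subgroup.index_ne_zero_of_finite

end Summit.HodgeConjecture.HodgeConjecture.Cruxes.H413.K2E5QuatLocalLevelFinite

end
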